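import Summits.RiemannHypothesis.RiemannHypothesis.Theses.UniversalFactor
import Literature.NumberTheory.LFunctions.DeBruijnHZeroProofs
import Literature.NumberTheory.LFunctions.DeBruijnNewmanProofs
import Literature.NumberTheory.LFunctions.EulerMaclaurinZeta
import Literature.Analysis.SpecialFunctions.GammaStirlingOrder

/-!
# RiemannHypothesis / UniversalFactor — exponential decay of `H_0` on the real axis

Route `RiemannHypothesis/UniversalFactor`, support for the wide-kernel window of the target
`LaplaceLoophole` (items `WideKernelTail`, `WideKernelNoGo`, stmt-RiemannHypothesis-2581/2578; this
file `--supports stmt-RiemannHypothesis-2575`). The route's docstrings use throughout the decay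
`|H_0(x)| ≪ x^A e^{−πx/8}` of de Bruijn's `H_0(x) = ξ(1/2 + ix/2)/8` (i.e. `Ξ(t) ≪ t^A e^{−πt/4}`,
Titchmarsh §10.1: on the critical line `|Γ(s/2)| ≍ |t|^{−1/4} e^{−π|t|/4}` while `ζ` and `s(s−1)`
grow polynomially). We prove it here, sorry-free, from tree facts:

* `UniversalFactor.norm_riemannXi_eq_of_re_pos` — `‖ξ(s)‖ = ‖s(s−1)‖/2 · ‖Γ_ℝ(s)‖ · ‖ζ(s)‖`
  (`Re s > 0`, `s ≠ 1`);
* `UniversalFactor.norm_Gammaℝ_half_line_le` — `‖Γ_ℝ(1/2 + ix/2)‖ ≤ 16π²(1 + |x|) e^{−π|x|/8}` for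
  `|x| ≥ 4` (from `Literature.Analysis.SpecialFunctions.norm_Gamma_le_exp`, Stirling order);
* `UniversalFactor.norm_riemannZeta_half_line_le` — `‖ζ(1/2 + ix/2)‖ ≤ (3 + |x|)³`
  (Euler–Maclaurin, `norm_riemannZeta_le_of_neg_one_le_re`);
* `UniversalFactor.norm_deBruijnH_zero_le_of_four_le` — `‖H_0(x)‖ ≤ π²(3 + |x|)⁶ e^{−π|x|/8}`,
  `|x| ≥ 4`;
* `UniversalFactor.exists_norm_deBruijnH_zero_le` — **for every `0 ≤ b < π/8` there is `C > 0` with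
  `‖H_0(x)‖ ≤ C e^{−b|x|}` for all real `x`.**

References: E. C. Titchmarsh, *The theory of the Riemann zeta-function*, 2nd ed. (1986), §2.1
(2.1.12), §4.12, §10.1; H. M. Edwards, *Riemann's zeta function* (1974), §6.4.
-/

noncomputable section

namespace Summit.RiemannHypothesis.RiemannHypothesis.Theorems

open Complex Literature.NumberTheory.LFunctions

/-- `‖ξ(s)‖ = ‖s(s−1)‖/2 · ‖Γ_ℝ(s)‖ · ‖ζ(s)‖` for `Re s > 0`, `s ≠ 1` (`ξ = ½ s(s−1) Λ`,
`Λ = Γ_ℝ ζ`). [cite: Titchmarsh1986, §2.1 (2.1.12)] -/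
theorem UniversalFactor.norm_riemannXi_eq_of_re_pos {s : ℂ} (hs0 : 0 < s.re) (hs1 : s ≠ 1) :
    ‖riemannXi s‖ = ‖s * (s - 1)‖ / 2 * ‖Gammaℝ s‖ * ‖riemannZeta s‖ := by
  have hs : s ≠ 0 := fun h ↦ by rw [h, zero_re] at hs0; exact lt_irrefl _ hs0
  have hG : Gammaℝ s ≠ 0 := Gammaℝ_ne_zero_of_re_pos hs0
  rw [riemannXi_eq_mul_completedRiemannZeta hs hs1, riemannZeta_def_of_ne_zero hs, norm_mul,
    norm_div, norm_div, Complex.norm_ofNat]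
  field_simp

/-- **Stirling on the critical line**: `‖Γ_ℝ(1/2 + ix/2)‖ ≤ 16π² (1 + |x|) e^{−π|x|/8}` for `|x| ≥ 4`
(`Γ_ℝ(w) = π^{−w/2} Γ(w/2)`, `‖π^{−w/2}‖ = π^{−1/4} ≤ 1`, and
`‖Γ(1/4 + ix/4)‖ ≤ 16π²(1 + |x|/4)^{1/2} e^{−π|x|/8}`). [cite: Titchmarsh1986, §4.12 (4.12.2)] -/
theorem UniversalFactor.norm_Gammaℝ_half_line_le {x : ℝ} (hx : 4 ≤ |x|) :
    ‖Gammaℝ (1 / 2 + I * x / 2)‖ ≤ 16 * Real.pi ^ 2 * (1 + |x|) * Real.exp (-(Real.pi * |x|) / 8) := by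
  rw [Gammaℝ_def, norm_mul]
  have hπ3 := Real.pi_gt_three
  have hπ : ‖(Real.pi : ℂ) ^ (-(1 / 2 + I * x / 2) / 2)‖ ≤ 1 := by
    rw [Complex.norm_cpow_eq_rpow_re_of_pos Real.pi_pos]
    have hre : (-(1 / 2 + I * (x : ℂ) / 2) / 2).re = -(1 / 4 : ℝ) := by
      simp; norm_num
    rw [hre]
    exact Real.rpow_le_one_of_one_le_of_nonpos (by linarith) (by norm_num)
  have hw2 : (1 / 2 + I * (x : ℂ) / 2) / 2 = ((1 / 4 : ℝ) : ℂ) + ((x / 4 : ℝ) : ℂ) * I := by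
    push_cast; ring
  have hx4 : |x / 4| = |x| / 4 := by rw [abs_div, abs_of_pos (by norm_num : (0 : ℝ) < 4)]
  have hy : 1 ≤ |x / 4| := by rw [hx4]; linarith
  have hΓ := Literature.Analysis.SpecialFunctions.norm_Gamma_le_exp (x := 1 / 4) (y := x / 4)
    (by norm_num) (by norm_num) hy
  rw [hw2]
  have h1 : (1 + |x / 4|) ^ (1 / 2 : ℝ) ≤ 1 + |x| := by
    have hb : 1 ≤ 1 + |x / 4| := by linarith [abs_nonneg (x / 4)]
    calc (1 + |x / 4|) ^ (1 / 2 : ℝ) ≤ (1 + |x / 4|) ^ (1 : ℝ) :=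
          Real.rpow_le_rpow_of_exponent_le hb (by norm_num)
      _ = 1 + |x / 4| := Real.rpow_one _
      _ ≤ 1 + |x| := by rw [hx4]; linarith [abs_nonneg x]
  have h2 : Real.exp (-(Real.pi * |x / 4|) / 2) = Real.exp (-(Real.pi * |x|) / 8) := by
    congr 1; rw [hx4]; ring
  calc ‖(Real.pi : ℂ) ^ (-(1 / 2 + I * x / 2) / 2)‖ * ‖Gamma (((1 / 4 : ℝ) : ℂ) + ((x / 4 : ℝ) : ℂ) * I)‖
      ≤ 1 * (16 * Real.pi ^ 2 * (1 + |x / 4|) ^ (1 / 2 : ℝ) * Real.exp (-(Real.pi * |x / 4|) / 2)) :=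
        mul_le_mul hπ hΓ (norm_nonneg _) zero_le_one
    _ ≤ 16 * Real.pi ^ 2 * (1 + |x|) * Real.exp (-(Real.pi * |x|) / 8) := by
        rw [one_mul, h2]; gcongr

/-- **`ζ` on the critical line grows polynomially**: `‖ζ(1/2 + ix/2)‖ ≤ (3 + |x|)³` (crude
consequence of `‖ζ(s)‖ ≤ 1/‖s−1‖ + 1/2 + ‖s‖/12 + ‖s‖‖s+1‖‖s+2‖/48` on `Re s ≥ −1`).
[cite: Edwards1974, §6.4 eq. (1)] -/
theorem UniversalFactor.norm_riemannZeta_half_line_le (x : ℝ) :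
    ‖riemannZeta (1 / 2 + I * x / 2)‖ ≤ (3 + |x|) ^ 3 := by
  set w : ℂ := 1 / 2 + I * x / 2 with hw
  have hre : w.re = 1 / 2 := by simp [hw]
  have hw1 : w ≠ 1 := by
    intro h; have := congrArg Complex.re h; rw [hre] at this; norm_num at this
  have h := norm_riemannZeta_le_of_neg_one_le_re (s := w) (by rw [hre]; norm_num) hw1
  have hIx : ‖I * (x : ℂ) / 2‖ = |x| / 2 := by
    rw [norm_div, norm_mul, Complex.norm_I, one_mul, Complex.norm_real, Real.norm_eq_abs,
      Complex.norm_ofNat]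
  have hn : ‖w‖ ≤ 1 + |x| := by
    calc ‖w‖ ≤ ‖(1 / 2 : ℂ)‖ + ‖I * (x : ℂ) / 2‖ := norm_add_le _ _
      _ = 1 / 2 + |x| / 2 := by rw [hIx]; norm_num
      _ ≤ 1 + |x| := by linarith [abs_nonneg x]
  have hn1 : 1 / 2 ≤ ‖w - 1‖ := by
    have h1 := Complex.abs_re_le_norm (w - 1)
    have h2 : (w - 1).re = -(1 / 2 : ℝ) := by rw [sub_re, hre, one_re]; norm_num
    rw [h2, abs_neg, abs_of_pos (by norm_num : (0 : ℝ) < 1 / 2)] at h1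
    exact h1
  have hn2 : ‖w + 1‖ ≤ 2 + |x| := by
    calc ‖w + 1‖ ≤ ‖w‖ + ‖(1 : ℂ)‖ := norm_add_le _ _
      _ ≤ 1 + |x| + 1 := by rw [norm_one]; linarith
      _ = 2 + |x| := by ring
  have hn3 : ‖w + 2‖ ≤ 3 + |x| := by
    calc ‖w + 2‖ ≤ ‖w‖ + ‖(2 : ℂ)‖ := norm_add_le _ _
      _ ≤ 1 + |x| + 2 := by rw [Complex.norm_ofNat]; linarith
      _ = 3 + |x| := by ring
  have hinv : 1 / ‖w - 1‖ ≤ 2 := by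
    rw [div_le_iff₀ (lt_of_lt_of_le (by norm_num) hn1)]; linarith
  have ht := abs_nonneg x
  calc ‖riemannZeta w‖ ≤ 1 / ‖w - 1‖ + 1 / 2 + ‖w‖ / 12 + ‖w‖ * ‖w + 1‖ * ‖w + 2‖ / 48 := h
    _ ≤ 2 + 1 / 2 + (1 + |x|) / 12 + (1 + |x|) * (2 + |x|) * (3 + |x|) / 48 := by
        gcongr
    _ ≤ (3 + |x|) ^ 3 := by nlinarith [mul_nonneg ht ht, mul_nonneg (mul_nonneg ht ht) ht]

/-- **`H_0` on the real axis, quantitatively**: `‖H_0(x)‖ ≤ π² (3 + |x|)⁶ e^{−π|x|/8}` for `|x| ≥ 4`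
(`H_0(x) = ξ(1/2 + ix/2)/8` = `deBruijnH_zero_eq_holds`, and the three factor bounds above).
[cite: Titchmarsh1986, §10.1] -/
theorem UniversalFactor.norm_deBruijnH_zero_le_of_four_le {x : ℝ} (hx : 4 ≤ |x|) :
    ‖deBruijnH 0 x‖ ≤ Real.pi ^ 2 * (3 + |x|) ^ 6 * Real.exp (-(Real.pi * |x|) / 8) := by
  rw [deBruijnH_zero_eq_holds x, norm_div, Complex.norm_ofNat]
  set w : ℂ := 1 / 2 + I * x / 2 with hw
  have hre : w.re = 1 / 2 := by simp [hw]
  have hw0 : 0 < w.re := by rw [hre]; norm_num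
  have hw1 : w ≠ 1 := by
    intro h; have := congrArg Complex.re h; rw [hre] at this; norm_num at this
  rw [UniversalFactor.norm_riemannXi_eq_of_re_pos hw0 hw1]
  have hIx : ‖I * (x : ℂ) / 2‖ = |x| / 2 := by
    rw [norm_div, norm_mul, Complex.norm_I, one_mul, Complex.norm_real, Real.norm_eq_abs,
      Complex.norm_ofNat]
  have hn : ‖w‖ ≤ 1 + |x| := by
    calc ‖w‖ ≤ ‖(1 / 2 : ℂ)‖ + ‖I * (x : ℂ) / 2‖ := norm_add_le _ _
      _ = 1 / 2 + |x| / 2 := by rw [hIx]; norm_num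
      _ ≤ 1 + |x| := by linarith [abs_nonneg x]
  have hn' : ‖w - 1‖ ≤ 1 + |x| := by
    calc ‖w - 1‖ ≤ ‖w‖ + ‖(1 : ℂ)‖ := norm_sub_le _ _
      _ ≤ 1 / 2 + |x| / 2 + 1 := by
          rw [norm_one]
          have : ‖w‖ ≤ 1 / 2 + |x| / 2 := by
            calc ‖w‖ ≤ ‖(1 / 2 : ℂ)‖ + ‖I * (x : ℂ) / 2‖ := norm_add_le _ _
              _ = 1 / 2 + |x| / 2 := by rw [hIx]; norm_num
          linarith
      _ ≤ 1 + |x| := by linarith [abs_nonneg x]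
  have hA : ‖w * (w - 1)‖ ≤ (1 + |x|) ^ 2 := by
    rw [norm_mul, sq]; exact mul_le_mul hn hn' (norm_nonneg _) (by positivity)
  have hB := UniversalFactor.norm_Gammaℝ_half_line_le hx
  have hC := UniversalFactor.norm_riemannZeta_half_line_le x
  have ht := abs_nonneg x
  have hE := Real.exp_pos (-(Real.pi * |x|) / 8)
  have hπ := Real.pi_pos
  calc ‖w * (w - 1)‖ / 2 * ‖Gammaℝ w‖ * ‖riemannZeta w‖ / 8
      ≤ (1 + |x|) ^ 2 / 2 * (16 * Real.pi ^ 2 * (1 + |x|) * Real.exp (-(Real.pi * |x|) / 8)) *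
          (3 + |x|) ^ 3 / 8 := by gcongr
    _ = Real.pi ^ 2 * ((1 + |x|) ^ 3 * (3 + |x|) ^ 3) * Real.exp (-(Real.pi * |x|) / 8) := by ring
    _ ≤ Real.pi ^ 2 * ((3 + |x|) ^ 3 * (3 + |x|) ^ 3) * Real.exp (-(Real.pi * |x|) / 8) := by
        gcongr; linarith
    _ = Real.pi ^ 2 * (3 + |x|) ^ 6 * Real.exp (-(Real.pi * |x|) / 8) := by ring

/-- **Exponential decay of `H_0` on the real axis**: for every `0 ≤ b < π/8` there is `C > 0` with
`‖H_0(x)‖ ≤ C e^{−b|x|}` for all real `x` (the polynomial factor is absorbed by `e^{y} ≥ y⁶/6!`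
with `y = (π/8 − b)(3 + |x|)`; on `|x| ≤ 4` continuity suffices). This is the decay
`Ξ(t) ≪_ε e^{−(π/4 − ε)|t|}` behind the route's items `WideKernelTail` / `WideKernelNoGo`.
[cite: Titchmarsh1986, §10.1] -/
theorem UniversalFactor.exists_norm_deBruijnH_zero_le {b : ℝ} (hb0 : 0 ≤ b) (hb : b < Real.pi / 8) :
    ∃ C : ℝ, 0 < C ∧ ∀ x : ℝ, ‖deBruijnH 0 x‖ ≤ C * Real.exp (-(b * |x|)) := by
  set ε : ℝ := Real.pi / 8 - b with hε
  have hε0 : 0 < ε := by rw [hε]; linarith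
  -- absorption of the polynomial factor
  have hpoly : ∀ t : ℝ, 0 ≤ t → (3 + t) ^ 6 * Real.exp (-(Real.pi * t) / 8) ≤
      720 / ε ^ 6 * Real.exp (3 * ε) * Real.exp (-(b * t)) := by
    intro t ht
    have h1 := Real.pow_div_factorial_le_exp (x := ε * (3 + t)) (by positivity) 6
    have hf : (Nat.factorial 6 : ℝ) = 720 := by norm_num [Nat.factorial]
    rw [hf, div_le_iff₀ (by norm_num : (0 : ℝ) < 720)] at h1
    -- `(3+t)^6 ≤ 720 e^{ε(3+t)} / ε^6`
    have h2 : (3 + t) ^ 6 ≤ 720 / ε ^ 6 * Real.exp (ε * (3 + t)) := by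
      rw [div_mul_eq_mul_div, le_div_iff₀ (by positivity), mul_comm]
      calc ε ^ 6 * (3 + t) ^ 6 = (ε * (3 + t)) ^ 6 := by ring
        _ ≤ Real.exp (ε * (3 + t)) * 720 := h1
        _ = 720 * Real.exp (ε * (3 + t)) := mul_comm _ _
    have h3 : Real.exp (ε * (3 + t)) * Real.exp (-(Real.pi * t) / 8) =
        Real.exp (3 * ε) * Real.exp (-(b * t)) := by
      rw [← Real.exp_add, ← Real.exp_add]; congr 1; rw [hε]; ring
    calc (3 + t) ^ 6 * Real.exp (-(Real.pi * t) / 8)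
        ≤ 720 / ε ^ 6 * Real.exp (ε * (3 + t)) * Real.exp (-(Real.pi * t) / 8) := by gcongr
      _ = 720 / ε ^ 6 * Real.exp (3 * ε) * Real.exp (-(b * t)) := by rw [mul_assoc, h3, mul_assoc]
  -- the compact part
  have hcont : Continuous fun x : ℝ ↦ deBruijnH 0 x :=
    (differentiable_deBruijnH_holds 0).continuous.comp Complex.continuous_ofReal
  obtain ⟨M, hM⟩ := (isCompact_closedBall (0 : ℝ) 4).exists_bound_of_continuousOn hcont.continuousOn
  set K : ℝ := Real.pi ^ 2 * (720 / ε ^ 6 * Real.exp (3 * ε)) with hK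
  have hK0 : 0 < K := by positivity
  refine ⟨K + max M 0 * Real.exp (4 * b), by positivity, fun x ↦ ?_⟩
  have ht := abs_nonneg x
  have hE := Real.exp_pos (-(b * |x|))
  rcases le_or_gt 4 |x| with hx | hx
  · calc ‖deBruijnH 0 x‖ ≤ Real.pi ^ 2 * (3 + |x|) ^ 6 * Real.exp (-(Real.pi * |x|) / 8) :=
          UniversalFactor.norm_deBruijnH_zero_le_of_four_le hx
      _ = Real.pi ^ 2 * ((3 + |x|) ^ 6 * Real.exp (-(Real.pi * |x|) / 8)) := by ring
      _ ≤ Real.pi ^ 2 * (720 / ε ^ 6 * Real.exp (3 * ε) * Real.exp (-(b * |x|))) :=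
          mul_le_mul_of_nonneg_left (hpoly |x| ht) (by positivity)
      _ = K * Real.exp (-(b * |x|)) := by rw [hK]; ring
      _ ≤ (K + max M 0 * Real.exp (4 * b)) * Real.exp (-(b * |x|)) := by
          gcongr; exact le_add_of_nonneg_right (by positivity)
  · have hxM : ‖deBruijnH 0 x‖ ≤ max M 0 := by
      refine (hM x ?_).trans (le_max_left _ _)
      rw [Metric.mem_closedBall, dist_zero_right, Real.norm_eq_abs]; exact hx.le
    have hexp : 1 ≤ Real.exp (4 * b) * Real.exp (-(b * |x|)) := by
      rw [← Real.exp_add]; exact Real.one_le_exp (by nlinarith)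
    calc ‖deBruijnH 0 x‖ ≤ max M 0 * 1 := by rw [mul_one]; exact hxM
      _ ≤ max M 0 * (Real.exp (4 * b) * Real.exp (-(b * |x|))) :=
          mul_le_mul_of_nonneg_left hexp (le_max_right _ _)
      _ = max M 0 * Real.exp (4 * b) * Real.exp (-(b * |x|)) := by ring
      _ ≤ (K + max M 0 * Real.exp (4 * b)) * Real.exp (-(b * |x|)) := by
          gcongr; exact le_add_of_nonneg_left hK0.le

end Summit.RiemannHypothesis.RiemannHypothesis.Theorems
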